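import Summits.HodgeConjecture.HodgeConjecture.Theorems.MarkmanPartnerTransportPicardThreeK3SquaresKugaSatakeSimilitude
import Summits.HodgeConjecture.HodgeConjecture.Theorems.MarkmanPartnerTransportPicardThreeK3SquaresKugaSatakeSelfSimilitude

/-!
# Route MarkmanPartnerTransport · crux `PicardThreeK3Squares` (stmt-HodgeConjecture-19652) —
# the real-quadratic RM K3 squares are conditional on the Kuga–Satake statement ALONE:
# gen 9's chain `…KugaSatakeSimilitude` WITHOUT the named fact `Varesco2023_…`

Gen 9 (`…PicardThreeK3SquaresKugaSatakeSimilitude`) proved, for a marked projective K3 surface `S` whose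
Kuga–Satake correspondence is algebraic (`IsKSCorrespondenceAlgebraicBetti`, HYPOTHESIS), that a rational
Hodge self-similitude `ψ` of `T(S)` is algebraic on `T(S)`, hence cycle-induced, hence
`HodgeConjectureFor 4 (S ⊗ S)` when `End_Hdg T(S) = ℚ[ψ]` is real quadratic — all MODULO the named
fact `Surfaces.Varesco2023_transcendentalHodgeSimilitude_algebraic_of_kugaSatake_K3` (Varesco, Math.
Z. 2023, Thm. 5.3). The programme «KS-SELF» (files `…TranscendentalPresentation`,
`…KugaSatakeSimilarTransport`, `…KugaSatakeSelfPresentation`, `…KugaSatakeSelfClassMap`,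
`…KugaSatakeSelfTranspose`, `…KugaSatakeSelfSimilitude`) proves the self-similitude case of
Varesco's theorem in the tree (two presentations of the transcendental part, one Kuga–Satake variety,
Lefschetz–transpose, Hodge–Riemann, Zarhin's field, subfield trick — no deformation argument). This
file re-derives gen 9's four theorems WITHOUT `hVar`:

* `exists_algebraicCorrespondence_eq_of_selfSimilitude_of_kugaSatake'`,
* `exists_corr_eq_on_transcendental_of_selfSimilitude_of_kugaSatake'`,
* `isCycleInduced_of_selfSimilitude_of_kugaSatake'`,
* `hodgeConjectureFor_square_of_selfSimilitude_generator_of_kugaSatake'` — **HC⁴(S × S) for a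
  projective K3 surface with REAL-QUADRATIC endomorphism field generated by a self-similitude,
  CONDITIONAL ONLY on the Kuga–Satake statement for `S`** (no named fact).

CONDITIONAL on `IsKSCorrespondenceAlgebraicBetti` (open in print for a general K3 surface; no instance
in the RM cells of the crux); no definition, no named fact, no sorry; credits nothing to the Hodge
conjecture — nothing here says HC or the crux is proved. Prover seat hodge-nonav-19652-p1 (gen 14),
`--supports stmt-HodgeConjecture-19652`.

References: M. Varesco, Math. Z. 305 (2023), Thm. 5.3, Cor. 4.6, Conj. 4.2; S. Floccari, Geom. Topol.
30 (2026) §3.3 Rem. 3.4; B. van Geemen (2000), §10.2–10.3; van Geemen–Schütt, Forum Math. Sigma 13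
(2025), §2.1, §4.8; W. Fulton, *Intersection theory*, §16.1 Prop. 16.1.1.
-/

set_option linter.dupNamespace false

noncomputable section

namespace Summit.HodgeConjecture.HodgeConjecture.Theorems.MarkmanPartnerTransport.KugaSatakeSimilitude

open Module CategoryTheory MonoidalCategory CartesianMonoidalCategory
open Literature.AlgebraicGeometry Literature.AlgebraicGeometry.Motives Literature.AlgebraicGeometry.HodgeTheory
open Literature.AlgebraicGeometry.Hyperkaehler Literature.AlgebraicGeometry.Surfaces
open Literature.AlgebraicTopology.SingularHomology
open Summit.HodgeConjecture.HodgeConjecture.Theorems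
open Summit.HodgeConjecture.HodgeConjecture.Theorems.MarkmanPartnerTransport

variable {S : SchemeOver ℂ} {η : complexBetti S (2 * 1) ≃ₗ[ℂ] (K3Index → ℂ)} {p : complexBetti S (2 * 2)}
  {x : K3Index → ℂ}

/-- `MarkedK3[S, η, p, x]`: VERBATIM the `let MarkedK3 := …` binder of the route declaration
`PicardThreeK3Squares`. Local notation only. -/
local notation3 (prettyPrint := false) "MarkedK3[" S ", " η ", " p ", " x "]" =>
  (p ≠ 0 ∧ (IsIntegralClass p ∧
    (∀ q : complexBetti S (2 * 2), IsIntegralClass q → ∃ n : ℤ, q = n • p) ∧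
    (∀ c : complexBetti S (2 * 1), IsIntegralClass c ↔ ∃ v : K3Index → ℤ, η c = fun i => (v i : ℂ)) ∧
    (∀ a b : complexBetti S (2 * 1),
      cupProduct (rfl : 2 * 1 + 2 * 1 = 2 * 2) a b = k3Form (η a) (η b) • p) ∧
    IsOfHodgeType 2 S (2 * 1) 2 0 (LinearEquiv.symm η x) ∧
    (∀ τ : complexBetti S (2 * 1), IsOfHodgeType 2 S (2 * 1) 2 0 τ →
      ∃ t : ℂ, τ = t • LinearEquiv.symm η x)) ∧
    (k3Form x x = 0 ∧ 0 < (k3Form (star x) x).re ∧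
      ∃ u : K3Index → ℤ, k3Form (fun i => (u i : ℂ)) x = 0 ∧ 0 < ∑ i, ∑ j, u i * k3Gram i j * u j))

/-- `Corr[μ, hS ; γ, y] = fst_*(snd^* y ∪ γ)` on `H²(S(ℂ); ℂ)` (`hS : IsSmoothProjective 2 S`). Local notation only. -/
local notation3 (prettyPrint := false) "Corr[" μ ", " hS " ; " γ ", " y "]" =>
  complexGysin μ (IsSmoothProjective.tensor_holds hS hS) hS
    (SemiCartesianMonoidalCategory.fst _ _) (rfl : 2 * 1 + 2 * 2 + 2 * 2 = 2 * 1 + 2 * (2 + 2))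
    (cupProduct (rfl : 2 * 1 + 2 * 2 = 2 * 1 + 2 * 2)
      (complexBetti.map (SemiCartesianMonoidalCategory.snd _ _) (2 * 1) y) γ)

/-- `Transc[S, y]`: `y` is cup-orthogonal to `N¹(S) = algebraicClasses S 1`. Local notation only. -/
local notation3 (prettyPrint := false) "Transc[" S ", " y "]" =>
  (∀ d ∈ algebraicClasses S 1, cupProduct (rfl : 2 * 1 + 2 * 1 = 2 * 2) y d = 0)

/-- The `(2,0)`-class `η⁻¹ x` of a marking is non-zero (`(x̄·x) > 0`). [cite: Huybrechts2016K3, Ch. 6 §1.1] -/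
theorem marking_symm_ne_zero (hM : MarkedK3[S, η, p, x]) : LinearEquiv.symm η x ≠ 0 := by
  obtain ⟨-, -, -, hxpos, -⟩ := hM
  intro h0
  have hx : x = 0 := by
    have h := congrArg η h0
    rw [LinearEquiv.apply_symm_apply, map_zero] at h
    exact h
  subst hx
  simp [k3Form] at hxpos

/-- **A rational Hodge self-similitude of `T(S)` is algebraic on `T(S)`, granted Kuga–Satake for `S`
— WITHOUT Varesco's theorem.** Gen 9's `exists_algebraicCorrespondence_eq_of_selfSimilitude_of_kugaSatake`
with the hypothesis `hVar` removed: the marking supplies the `(2,0)`-line `ℂ η⁻¹x`, and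
`KugaSatakeSelf.exists_algebraicCorrespondence_eq_of_selfSimilitude_of_kugaSatake` does the rest.
CONDITIONAL on the Kuga–Satake hypothesis only. [cite: Varesco2023, Thm. 5.3 (§5), Cor. 4.6 and Thm. 4.5]
[cite: Floccari2026, §3.3 Rem. 3.4] -/
theorem exists_algebraicCorrespondence_eq_of_selfSimilitude_of_kugaSatake'
    (hS : IsK3Surface S) (hM : MarkedK3[S, η, p, x])
    (hKS : IsKSCorrespondenceAlgebraicBetti hS.isSmoothProjective)
    (ψ : complexBetti S (2 * 1) →ₗ[ℂ] complexBetti S (2 * 1))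
    (h1 : ∀ y, IsRationalClass y → IsRationalClass (ψ y))
    (h2 : ∀ (i j : ℕ) y, IsOfHodgeType 2 S (2 * 1) i j y → IsOfHodgeType 2 S (2 * 1) i j (ψ y))
    (h4 : ∀ y : complexBetti S (2 * 1), Transc[S, ψ y])
    (h5 : ∀ y w : complexBetti S (2 * 1),
      cupProduct (rfl : 2 * 1 + 2 * 1 = 2 * 2) (ψ y) w = cupProduct (rfl : 2 * 1 + 2 * 1 = 2 * 2) y (ψ w))
    (d : ℚ) (hd : d ≠ 0) (hψψ : ∀ y : complexBetti S (2 * 1), Transc[S, y] → ψ (ψ y) = (d : ℂ) • y) :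
    ∃ T : complexBetti S (2 * 1) →ₗ[ℂ] complexBetti S (2 * 1), IsAlgebraicCorrespondence 2 2 S S T ∧
      ∀ y : complexBetti S (2 * 1), Transc[S, y] → T y = ψ y := by
  have hσ0 := marking_symm_ne_zero hM
  obtain ⟨-, ⟨-, -, -, -, hx20, hline⟩, -⟩ := hM
  exact KugaSatakeSelf.exists_algebraicCorrespondence_eq_of_selfSimilitude_of_kugaSatake hS.isSmoothProjective
    hx20 hσ0 hline hKS ψ h1 h2 h4 h5 d hd hψψ

/-- **A rational Hodge self-similitude of `T(S)` is `[γ]_*` on `T(S)` for an algebraic `γ ∈ A²(S × S)`,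
granted Kuga–Satake for `S`** — gen 9's statement without `hVar`. [cite: Varesco2023, Thm. 5.3 (§5)]
[cite: Fulton1998, §16.1 Prop. 16.1.1] -/
theorem exists_corr_eq_on_transcendental_of_selfSimilitude_of_kugaSatake'
    (hS : IsK3Surface S) (hM : MarkedK3[S, η, p, x])
    (hKS : IsKSCorrespondenceAlgebraicBetti hS.isSmoothProjective)
    (ψ : complexBetti S (2 * 1) →ₗ[ℂ] complexBetti S (2 * 1))
    (h1 : ∀ y, IsRationalClass y → IsRationalClass (ψ y))
    (h2 : ∀ (i j : ℕ) y, IsOfHodgeType 2 S (2 * 1) i j y → IsOfHodgeType 2 S (2 * 1) i j (ψ y))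
    (h4 : ∀ y : complexBetti S (2 * 1), Transc[S, ψ y])
    (h5 : ∀ y w : complexBetti S (2 * 1),
      cupProduct (rfl : 2 * 1 + 2 * 1 = 2 * 2) (ψ y) w = cupProduct (rfl : 2 * 1 + 2 * 1 = 2 * 2) y (ψ w))
    (d : ℚ) (hd : d ≠ 0) (hψψ : ∀ y : complexBetti S (2 * 1), Transc[S, y] → ψ (ψ y) = (d : ℂ) • y) :
    ∃ γ ∈ algebraicClasses (S ⊗ S) 2, ∀ y : complexBetti S (2 * 1), Transc[S, y] →
      Corr[complexOrientationFamily, hS.isSmoothProjective ; γ, y] = ψ y := by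
  obtain ⟨T, hTalg, hTψ⟩ := exists_algebraicCorrespondence_eq_of_selfSimilitude_of_kugaSatake' hS hM hKS ψ
    h1 h2 h4 h5 d hd hψψ
  obtain ⟨e, hab, γ, hγ, hT⟩ :=
    Summit.HodgeConjecture.HodgeConjecture.Ring2.AbelianAll.IsAlgebraicCorrespondence.exists_eq_corrAction
      hS.isSmoothProjective hS.isSmoothProjective hTalg
  obtain rfl : e = 2 := by omega
  refine ⟨γ, hγ, fun y hy => ?_⟩
  rw [corr_eq_corrAction_two hS.isSmoothProjective hab, ← hTψ y hy, hT]

/-- **A rational Hodge self-similitude of `T(S)`, extended by `0` on `N¹(S)`, is CYCLE-INDUCED, granted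
Kuga–Satake for `S`** — gen 9's `isCycleInduced_of_selfSimilitude_of_kugaSatake` without `hVar`.
[cite: Varesco2023, Thm. 5.3 (§5) and §2 (p. 8)] [cite: GeemenSchutt2023, §4.8] -/
theorem isCycleInduced_of_selfSimilitude_of_kugaSatake'
    (hS : IsK3Surface S) (hM : MarkedK3[S, η, p, x])
    (hKS : IsKSCorrespondenceAlgebraicBetti hS.isSmoothProjective)
    (ψ : complexBetti S (2 * 1) →ₗ[ℂ] complexBetti S (2 * 1))
    (h1 : ∀ y, IsRationalClass y → IsRationalClass (ψ y))
    (h2 : ∀ (i j : ℕ) y, IsOfHodgeType 2 S (2 * 1) i j y → IsOfHodgeType 2 S (2 * 1) i j (ψ y))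
    (h3 : ∀ d ∈ algebraicClasses S 1, ψ d = 0)
    (h4 : ∀ y : complexBetti S (2 * 1), Transc[S, ψ y])
    (h5 : ∀ y w : complexBetti S (2 * 1),
      cupProduct (rfl : 2 * 1 + 2 * 1 = 2 * 2) (ψ y) w = cupProduct (rfl : 2 * 1 + 2 * 1 = 2 * 2) y (ψ w))
    (d : ℚ) (hd : d ≠ 0) (hψψ : ∀ y : complexBetti S (2 * 1), Transc[S, y] → ψ (ψ y) = (d : ℂ) • y) :
    IsCycleInducedTranscendentalEndomorphism S hS.isSmoothProjective ψ := by
  obtain ⟨γ, hγ, hγψ⟩ := exists_corr_eq_on_transcendental_of_selfSimilitude_of_kugaSatake' hS hM hKS ψ h1 h2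
    h4 h5 d hd hψψ
  have hγψ' : ∀ y ∈ transcendentalSubspace S, Corr[complexOrientationFamily, hS.isSmoothProjective ; γ, y] = ψ y :=
    fun y hy => hγψ y ((mem_transcendentalSubspace_iff_forall_algebraicClasses hS.isSmoothProjective y).1 hy)
  obtain ⟨γ', hγ', hγ'ψ⟩ := QuotientSimilitude.exists_corr_eq_of_eq_on_transcendental hS hS ψ h3 hγ hγψ'
  exact ⟨h1, h2, h3, h4, γ', hγ', fun y => (hγ'ψ y).symm⟩

/-- **HC⁴(S × S) for a projective K3 surface with REAL-QUADRATIC endomorphism field, granted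
Kuga–Satake for `S` — with NO named fact.** Data: a marked projective K3 surface `(S, η, p, x)` with
algebraic Kuga–Satake correspondence (`IsKSCorrespondenceAlgebraicBetti`, HYPOTHESIS) and
`ψ ∈ End H²(S(ℂ); ℂ)` rational, type-preserving, killing `N¹(S)`, with image cup-orthogonal to
`N¹(S)`, cup-self-adjoint, `ψ² = d ≠ 0` on `T(S)`, and GENERATING (`End_Hdg T(S) = ℚ[ψ|_T] = ℚ + ℚψ`).
Then `HodgeConjectureFor 4 (S ⊗ S)` — gen 9's theorem without `hVar`; CONDITIONAL ONLY on the
Kuga–Satake statement for `S` (open in print). Credits nothing to HC. [cite: Varesco2023, Thm. 5.3, Cor. 4.6, Conj. 4.2]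
[cite: GeemenSchutt2023, §2.1 and §4.8] [cite: Fulton1998, §16.1 Prop. 16.1.1] -/
theorem hodgeConjectureFor_square_of_selfSimilitude_generator_of_kugaSatake'
    (hS : IsK3Surface S) (hM : MarkedK3[S, η, p, x])
    (hKS : IsKSCorrespondenceAlgebraicBetti hS.isSmoothProjective)
    (ψ : complexBetti S (2 * 1) →ₗ[ℂ] complexBetti S (2 * 1))
    (h1 : ∀ y, IsRationalClass y → IsRationalClass (ψ y))
    (h2 : ∀ (i j : ℕ) y, IsOfHodgeType 2 S (2 * 1) i j y → IsOfHodgeType 2 S (2 * 1) i j (ψ y))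
    (h3 : ∀ d ∈ algebraicClasses S 1, ψ d = 0)
    (h4 : ∀ y : complexBetti S (2 * 1), Transc[S, ψ y])
    (h5 : ∀ y w : complexBetti S (2 * 1),
      cupProduct (rfl : 2 * 1 + 2 * 1 = 2 * 2) (ψ y) w = cupProduct (rfl : 2 * 1 + 2 * 1 = 2 * 2) y (ψ w))
    (d : ℚ) (hd : d ≠ 0) (hψψ : ∀ y : complexBetti S (2 * 1), Transc[S, y] → ψ (ψ y) = (d : ℂ) • y)
    (hgen : TranscendentalEndomorphismsGeneratedBy S ψ) :
    HodgeConjectureFor 4 (S ⊗ S) :=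
  SquareOfGenerator.hodgeConjectureFor_tensor_self_of_generated hS ψ
    (isCycleInduced_of_selfSimilitude_of_kugaSatake' hS hM hKS ψ h1 h2 h3 h4 h5 d hd hψψ) hgen

end Summit.HodgeConjecture.HodgeConjecture.Theorems.MarkmanPartnerTransport.KugaSatakeSimilitude

end
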